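import Mathlib.Analysis.InnerProductSpace.Spectrum
import HarnessLib

/-!
# T⁴ programme, node NE3 — row E-MLw-(w4)-P-curved, row K1: THE SPECTRAL-CUT KIT (finite-dimensional linear algebra)

NE3 (node U1b), row NE3 OWNER `b2b-balaban-t4-ne3-p1` (gen 22), ruling ρ-g22-2 (journal l.17514), design memo
`HOME/t4/b2b-balaban-t4-ne3-p1/g22/D-ne3p1-g22-1.md` §2 step S2.

WHAT.  Route H♮ for the curved (P♮) splits the gauge potential `ζ` of the covariant Hodge decomposition `Y = η + D_Wζ` at the
spectral threshold `λ* = (ε∕L^k)²` of the (finite-dimensional, symmetric, positive) operator `T = D_W^* D_W` on sections: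
`ζ = c̃ + ζ′`, `c̃ = P_{<λ*}ζ` (near-covariantly-constant part — the small divisor), `ζ′ = P_{≥λ*}ζ`.  Everything the design
uses about the cut is abstract linear algebra over a real finite-dimensional inner-product space, proved here once:
for `T` symmetric with `0 ≤ ⟪T v, v⟫` and a threshold `θ`,
* `lowPart θ v + highPart θ v = v`                                   (`lowPart_add_highPart`);
* `⟪highPart θ v, T (lowPart θ v)⟫ = 0`                              (`inner_highPart_apply_lowPart`) — S2 (iii);
* `θ·‖highPart θ v‖² ≤ ⟪T (highPart θ v), highPart θ v⟫`              (`mul_norm_sq_highPart_le`) — S2 (i), no small divisor above θ;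
* `‖T (lowPart θ v)‖² ≤ θ·⟪T (lowPart θ v), lowPart θ v⟫`             (`norm_sq_apply_lowPart_le`) — S2 (ii), the low part has small image;
* `⟪T(lowPart), lowPart⟫ + ⟪T(highPart), highPart⟫ = ⟪T v, v⟫`, each `≤ ⟪T v, v⟫` (`inner_apply_lowPart_add`, `…_le`);
and the ENERGY FORM of the same facts when `⟪T v, v⟫ = ‖D v‖²` for some map `D` (`T = D^*D`): `θ‖highPart‖² ≤ ‖D highPart‖² ≤ ‖D v‖²`,
`‖T lowPart‖² ≤ θ‖D lowPart‖² ≤ θ‖D v‖²`.  Mechanism: Mathlib's spectral theorem `LinearMap.IsSymmetric.eigenvectorBasis` ∕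
`apply_eigenvectorBasis`; the parts are the coordinate truncations in that orthonormal eigenbasis.

CONTENT: DATA defs `lowCoeff`, `highCoeff`, `lowPart`, `highPart` (coordinate truncations; no `def … : Prop`); theorems as listed,
all [folklore]; 0 sorry.  The instantiation `T := D_W^*D_W` on periodic 𝔤-valued sections (leaf-01-g5's `PiLp` torus packaging) is
row K1-inst.

HONEST FRAMING.  Linear algebra; nothing about Bałaban's objects is asserted; (P♮)∕(ML_w) at the curved background, T-E_w and NE3
are NOT proved; spine PROVED 0∕9; finite T⁴ rung (B)+1 — NOT infinite volume, NOT mass gap, NOT BetaPertH, NOT Clay.  PLACEMENT: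
`Summits/QuantumFields/BalabanUV/` (our frame); imports Mathlib only.
-/

set_option autoImplicit false

open scoped BigOperators InnerProductSpace
open Finset

namespace Summit.QuantumFields.BalabanUV.T4Continuum.NE3SpectralCut

noncomputable section

variable {E : Type*} [NormedAddCommGroup E] [InnerProductSpace ℝ E] [FiniteDimensional ℝ E]
variable {T : E →ₗ[ℝ] E}

/-! ## §1 The coordinate truncations in an orthonormal eigenbasis -/

/-- The coordinates of `v` in the eigenbasis of `T`, kept only on eigenvalues `< θ`. [folklore] -/
def lowCoeff (hT : T.IsSymmetric) (θ : ℝ) (v : E) (i : Fin (Module.finrank ℝ E)) : ℝ :=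
  if hT.eigenvalues rfl i < θ then (hT.eigenvectorBasis rfl).repr v i else 0

/-- The coordinates of `v` in the eigenbasis of `T`, kept only on eigenvalues `≥ θ`. [folklore] -/
def highCoeff (hT : T.IsSymmetric) (θ : ℝ) (v : E) (i : Fin (Module.finrank ℝ E)) : ℝ :=
  if hT.eigenvalues rfl i < θ then 0 else (hT.eigenvectorBasis rfl).repr v i

/-- **THE LOW SPECTRAL PART** `P_{<θ} v` of `v` (span of the eigenvectors of `T` with eigenvalue `< θ`). [folklore] -/
def lowPart (hT : T.IsSymmetric) (θ : ℝ) (v : E) : E :=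
  ∑ i, lowCoeff hT θ v i • hT.eigenvectorBasis rfl i

/-- **THE HIGH SPECTRAL PART** `P_{≥θ} v` of `v`. [folklore] -/
def highPart (hT : T.IsSymmetric) (θ : ℝ) (v : E) : E :=
  ∑ i, highCoeff hT θ v i • hT.eigenvectorBasis rfl i

/-- Pointwise the two truncations add up to the coordinate. [folklore] -/
theorem lowCoeff_add_highCoeff (hT : T.IsSymmetric) (θ : ℝ) (v : E) (i : Fin (Module.finrank ℝ E)) :
    lowCoeff hT θ v i + highCoeff hT θ v i = (hT.eigenvectorBasis rfl).repr v i := by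
  unfold lowCoeff highCoeff
  split_ifs <;> simp

/-- Pointwise the two truncations have disjoint support. [folklore] -/
theorem lowCoeff_mul_highCoeff (hT : T.IsSymmetric) (θ : ℝ) (v : E) (i : Fin (Module.finrank ℝ E)) :
    lowCoeff hT θ v i * highCoeff hT θ v i = 0 := by
  unfold lowCoeff highCoeff
  split_ifs <;> simp

/-- **`P_{<θ} v + P_{≥θ} v = v`.** [folklore] -/
theorem lowPart_add_highPart (hT : T.IsSymmetric) (θ : ℝ) (v : E) : lowPart hT θ v + highPart hT θ v = v := by
  unfold lowPart highPart
  rw [← Finset.sum_add_distrib]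
  simp_rw [← add_smul, lowCoeff_add_highCoeff]
  exact (hT.eigenvectorBasis rfl).sum_repr v

/-! ## §2 Sums in the eigenbasis: the action of `T`, inner products, norms -/

/-- `T` acts diagonally on eigenbasis expansions: `T (Σ c_i • b_i) = Σ (μ_i c_i) • b_i`. [folklore] -/
theorem apply_sum_smul (hT : T.IsSymmetric) (c : Fin (Module.finrank ℝ E) → ℝ) :
    T (∑ i, c i • hT.eigenvectorBasis rfl i) = ∑ i, (hT.eigenvalues rfl i * c i) • hT.eigenvectorBasis rfl i := by
  rw [map_sum]
  refine Finset.sum_congr rfl fun i _ => ?_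
  rw [map_smul, hT.apply_eigenvectorBasis, smul_smul, mul_comm]
  rfl

/-- Inner product of two eigenbasis expansions: `⟪Σ a_i • b_i, Σ c_i • b_i⟫ = Σ a_i c_i`. [folklore] -/
theorem inner_sum_smul_sum_smul (hT : T.IsSymmetric) (a c : Fin (Module.finrank ℝ E) → ℝ) :
    ⟪∑ i, a i • hT.eigenvectorBasis rfl i, ∑ i, c i • hT.eigenvectorBasis rfl i⟫_ℝ = ∑ i, a i * c i := by
  rw [(hT.eigenvectorBasis rfl).orthonormal.inner_sum a c Finset.univ]
  simp

/-- Norm of an eigenbasis expansion: `‖Σ a_i • b_i‖² = Σ a_i²`. [folklore] -/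
theorem norm_sq_sum_smul (hT : T.IsSymmetric) (a : Fin (Module.finrank ℝ E) → ℝ) :
    ‖∑ i, a i • hT.eigenvectorBasis rfl i‖ ^ 2 = ∑ i, a i ^ 2 := by
  rw [← real_inner_self_eq_norm_sq, inner_sum_smul_sum_smul]
  exact Finset.sum_congr rfl fun i _ => by ring

/-- The eigenvalues of a POSITIVE symmetric operator are non-negative. [folklore] -/
theorem eigenvalues_nonneg (hT : T.IsSymmetric) (hpos : ∀ w : E, 0 ≤ ⟪T w, w⟫_ℝ) (i : Fin (Module.finrank ℝ E)) :
    0 ≤ hT.eigenvalues rfl i := by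
  have h := hpos (hT.eigenvectorBasis rfl i)
  rw [hT.apply_eigenvectorBasis, real_inner_smul_left, real_inner_self_eq_norm_sq,
    (hT.eigenvectorBasis rfl).orthonormal.1 i] at h
  simpa using h

/-! ## §3 The four facts of the spectral cut -/

/-- **S2 (iii) — ORTHOGONALITY ACROSS THE CUT**: `⟪P_{≥θ} v, T (P_{<θ} v)⟫ = 0`. [folklore] -/
theorem inner_highPart_apply_lowPart (hT : T.IsSymmetric) (θ : ℝ) (v : E) : ⟪highPart hT θ v, T (lowPart hT θ v)⟫_ℝ = 0 := by
  unfold highPart lowPart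
  rw [apply_sum_smul, inner_sum_smul_sum_smul]
  refine Finset.sum_eq_zero fun i _ => ?_
  have h := lowCoeff_mul_highCoeff hT θ v i
  calc highCoeff hT θ v i * (hT.eigenvalues rfl i * lowCoeff hT θ v i)
      = hT.eigenvalues rfl i * (lowCoeff hT θ v i * highCoeff hT θ v i) := by ring
    _ = 0 := by rw [h, mul_zero]

/-- The same with the parts exchanged: `⟪P_{<θ} v, T (P_{≥θ} v)⟫ = 0`. [folklore] -/
theorem inner_lowPart_apply_highPart (hT : T.IsSymmetric) (θ : ℝ) (v : E) : ⟪lowPart hT θ v, T (highPart hT θ v)⟫_ℝ = 0 := by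
  unfold highPart lowPart
  rw [apply_sum_smul, inner_sum_smul_sum_smul]
  refine Finset.sum_eq_zero fun i _ => ?_
  have h := lowCoeff_mul_highCoeff hT θ v i
  calc lowCoeff hT θ v i * (hT.eigenvalues rfl i * highCoeff hT θ v i)
      = hT.eigenvalues rfl i * (lowCoeff hT θ v i * highCoeff hT θ v i) := by ring
    _ = 0 := by rw [h, mul_zero]

/-- **S2 (i) — NO SMALL DIVISOR ABOVE THE CUT**: `θ·‖P_{≥θ} v‖² ≤ ⟪T (P_{≥θ} v), P_{≥θ} v⟫`. [folklore] -/
theorem mul_norm_sq_highPart_le (hT : T.IsSymmetric) (θ : ℝ) (v : E) : θ * ‖highPart hT θ v‖ ^ 2 ≤ ⟪T (highPart hT θ v), highPart hT θ v⟫_ℝ := by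
  unfold highPart
  rw [norm_sq_sum_smul, apply_sum_smul, inner_sum_smul_sum_smul, Finset.mul_sum]
  refine Finset.sum_le_sum fun i _ => ?_
  unfold highCoeff
  split_ifs with h
  · simp
  · have hge : θ ≤ hT.eigenvalues rfl i := le_of_not_gt h
    have h0 : 0 ≤ ((hT.eigenvectorBasis rfl).repr v i) ^ 2 := sq_nonneg _
    calc θ * ((hT.eigenvectorBasis rfl).repr v i) ^ 2
        ≤ hT.eigenvalues rfl i * ((hT.eigenvectorBasis rfl).repr v i) ^ 2 := mul_le_mul_of_nonneg_right hge h0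
      _ = hT.eigenvalues rfl i * (hT.eigenvectorBasis rfl).repr v i * (hT.eigenvectorBasis rfl).repr v i := by ring

/-- **S2 (ii) — THE LOW PART HAS A SMALL IMAGE** (positive `T`): `‖T (P_{<θ} v)‖² ≤ θ·⟪T (P_{<θ} v), P_{<θ} v⟫`. [folklore] -/
theorem norm_sq_apply_lowPart_le (hT : T.IsSymmetric) (θ : ℝ) (v : E) (hpos : ∀ w : E, 0 ≤ ⟪T w, w⟫_ℝ) :
    ‖T (lowPart hT θ v)‖ ^ 2 ≤ θ * ⟪T (lowPart hT θ v), lowPart hT θ v⟫_ℝ := by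
  unfold lowPart
  rw [apply_sum_smul, norm_sq_sum_smul, inner_sum_smul_sum_smul, Finset.mul_sum]
  refine Finset.sum_le_sum fun i _ => ?_
  have hμ := eigenvalues_nonneg hT hpos i
  unfold lowCoeff
  split_ifs with h
  · have h0 : 0 ≤ ((hT.eigenvectorBasis rfl).repr v i) ^ 2 := sq_nonneg _
    have hμθ : hT.eigenvalues rfl i * hT.eigenvalues rfl i ≤ θ * hT.eigenvalues rfl i :=
      mul_le_mul_of_nonneg_right (le_of_lt h) hμ
    calc (hT.eigenvalues rfl i * (hT.eigenvectorBasis rfl).repr v i) ^ 2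
        = (hT.eigenvalues rfl i * hT.eigenvalues rfl i) * ((hT.eigenvectorBasis rfl).repr v i) ^ 2 := by ring
      _ ≤ (θ * hT.eigenvalues rfl i) * ((hT.eigenvectorBasis rfl).repr v i) ^ 2 := mul_le_mul_of_nonneg_right hμθ h0
      _ = θ * (hT.eigenvalues rfl i * (hT.eigenvectorBasis rfl).repr v i * (hT.eigenvectorBasis rfl).repr v i) := by
          ring
  · simp

/-- **THE ENERGY SPLITS ACROSS THE CUT**: `⟪T(P_{<}v), P_{<}v⟫ + ⟪T(P_{≥}v), P_{≥}v⟫ = ⟪T v, v⟫`. [folklore] -/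
theorem inner_apply_lowPart_add (hT : T.IsSymmetric) (θ : ℝ) (v : E) : ⟪T (lowPart hT θ v), lowPart hT θ v⟫_ℝ + ⟪T (highPart hT θ v), highPart hT θ v⟫_ℝ
      = ⟪T v, v⟫_ℝ := by
  conv_rhs => rw [← lowPart_add_highPart hT θ v]
  rw [map_add, inner_add_left, inner_add_right, inner_add_right]
  have h1 : ⟪T (lowPart hT θ v), highPart hT θ v⟫_ℝ = 0 := by
    rw [real_inner_comm]; exact inner_highPart_apply_lowPart hT θ v
  have h2 : ⟪T (highPart hT θ v), lowPart hT θ v⟫_ℝ = 0 := by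
    rw [real_inner_comm]; exact inner_lowPart_apply_highPart hT θ v
  rw [h1, h2]
  ring

/-- Each part's energy is non-negative (positive `T`). [folklore] -/
theorem inner_apply_lowPart_nonneg (hT : T.IsSymmetric) (θ : ℝ) (v : E) (hpos : ∀ w : E, 0 ≤ ⟪T w, w⟫_ℝ) : 0 ≤ ⟪T (lowPart hT θ v), lowPart hT θ v⟫_ℝ :=
  hpos _

/-- … hence each part's energy is at most the total: low part. [folklore] -/
theorem inner_apply_lowPart_le (hT : T.IsSymmetric) (θ : ℝ) (v : E) (hpos : ∀ w : E, 0 ≤ ⟪T w, w⟫_ℝ) :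
    ⟪T (lowPart hT θ v), lowPart hT θ v⟫_ℝ ≤ ⟪T v, v⟫_ℝ := by
  have h := inner_apply_lowPart_add hT θ v
  have h2 : 0 ≤ ⟪T (highPart hT θ v), highPart hT θ v⟫_ℝ := hpos _
  linarith

/-- … and high part. [folklore] -/
theorem inner_apply_highPart_le (hT : T.IsSymmetric) (θ : ℝ) (v : E) (hpos : ∀ w : E, 0 ≤ ⟪T w, w⟫_ℝ) :
    ⟪T (highPart hT θ v), highPart hT θ v⟫_ℝ ≤ ⟪T v, v⟫_ℝ := by
  have h := inner_apply_lowPart_add hT θ v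
  have h2 : 0 ≤ ⟪T (lowPart hT θ v), lowPart hT θ v⟫_ℝ := hpos _
  linarith

/-! ## §4 The energy form: `⟪T v, v⟫ = ‖D v‖²` (`T = D^*D`) -/

section Energy

variable {F : Type*} [NormedAddCommGroup F]

omit [FiniteDimensional ℝ E] in
/-- With `⟪T w, w⟫ = ‖D w‖²` the operator is positive. [folklore] -/
theorem pos_of_energy (D : E → F) (hD : ∀ w : E, ⟪T w, w⟫_ℝ = ‖D w‖ ^ 2) : ∀ w : E, 0 ≤ ⟪T w, w⟫_ℝ :=
  fun w => by rw [hD w]; positivity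

/-- **S2 (i), energy form**: `θ·‖P_{≥θ} v‖² ≤ ‖D (P_{≥θ} v)‖² ≤ ‖D v‖²` (first inequality). [folklore] -/
theorem mul_norm_sq_highPart_le_energy (hT : T.IsSymmetric) (θ : ℝ) (v : E) (D : E → F) (hD : ∀ w : E, ⟪T w, w⟫_ℝ = ‖D w‖ ^ 2) : θ * ‖highPart hT θ v‖ ^ 2 ≤ ‖D (highPart hT θ v)‖ ^ 2 := by
  rw [← hD]; exact mul_norm_sq_highPart_le hT θ v

/-- The high part's energy is at most the total energy. [folklore] -/
theorem energy_highPart_le (hT : T.IsSymmetric) (θ : ℝ) (v : E) (D : E → F) (hD : ∀ w : E, ⟪T w, w⟫_ℝ = ‖D w‖ ^ 2) : ‖D (highPart hT θ v)‖ ^ 2 ≤ ‖D v‖ ^ 2 := by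
  rw [← hD, ← hD]; exact inner_apply_highPart_le hT θ v (pos_of_energy D hD)

/-- The low part's energy is at most the total energy. [folklore] -/
theorem energy_lowPart_le (hT : T.IsSymmetric) (θ : ℝ) (v : E) (D : E → F) (hD : ∀ w : E, ⟪T w, w⟫_ℝ = ‖D w‖ ^ 2) : ‖D (lowPart hT θ v)‖ ^ 2 ≤ ‖D v‖ ^ 2 := by
  rw [← hD, ← hD]; exact inner_apply_lowPart_le hT θ v (pos_of_energy D hD)

/-- **S2 (i), combined**: for `0 < θ`, `‖P_{≥θ} v‖² ≤ θ⁻¹·‖D v‖²` — above the cut the section is controlled by its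
derivative WITHOUT a small divisor. [folklore] -/
theorem norm_sq_highPart_le (hT : T.IsSymmetric) (θ : ℝ) (v : E) (D : E → F) (hD : ∀ w : E, ⟪T w, w⟫_ℝ = ‖D w‖ ^ 2) (hθ : 0 < θ) : ‖highPart hT θ v‖ ^ 2 ≤ θ⁻¹ * ‖D v‖ ^ 2 := by
  have h1 := mul_norm_sq_highPart_le_energy hT θ v D hD
  have h2 := energy_highPart_le hT θ v D hD
  rw [le_inv_mul_iff₀' hθ]
  calc ‖highPart hT θ v‖ ^ 2 * θ = θ * ‖highPart hT θ v‖ ^ 2 := mul_comm _ _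
    _ ≤ ‖D v‖ ^ 2 := h1.trans h2

/-- **S2 (ii), energy form**: `‖T (P_{<θ} v)‖² ≤ θ·‖D (P_{<θ} v)‖² ≤ θ·‖D v‖²` — below the cut the divergence
`D^*D c̃` is small. [folklore] -/
theorem norm_sq_apply_lowPart_le_energy (hT : T.IsSymmetric) (θ : ℝ) (v : E) (D : E → F) (hD : ∀ w : E, ⟪T w, w⟫_ℝ = ‖D w‖ ^ 2) (hθ : 0 ≤ θ) : ‖T (lowPart hT θ v)‖ ^ 2 ≤ θ * ‖D v‖ ^ 2 := by
  have h1 := norm_sq_apply_lowPart_le hT θ v (pos_of_energy D hD)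
  rw [hD] at h1
  exact h1.trans (mul_le_mul_of_nonneg_left (energy_lowPart_le hT θ v D hD) hθ)

end Energy

end

end Summit.QuantumFields.BalabanUV.T4Continuum.NE3SpectralCut
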